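import Mathlib.AlgebraicGeometry.Morphisms.Finite
import Mathlib.AlgebraicGeometry.Morphisms.Flat
import Mathlib.RingTheory.LocalRing.Module
import HarnessLib

/-!
# Finite (flat) schemes over an affine base: the coordinate ring as a finite (free) algebra
# ([StacksProject] Tags 01WG/01WJ (finite morphisms are affine, finite ⇝ finite module), 01U2 (flat morphisms and their base change), 00NZ (finite flat
# over a local ring is free); [GortzWedhorn2020] Ch. 12 (affine and finite morphisms), Ch. 14 (flat morphisms))

Topic `Literature/AlgebraicGeometry/Morphisms`, namespace `Literature.AlgebraicGeometry.Morphisms`.  THEOREMS only (no def, no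
instance, no notation, no named fact, no `sorry`); Mathlib-only imports.  Cell `hodgecm-mathlib` (D-0151), FLOOR 0, programme F0P5a,
crux item stmt-HodgeConjecture-24832 — row (L2a) of the (S-γ2) step list «specialisation of geometric fibres of a finite flat cover»
(F0P5a-p02 (g2) 2026-08-31T00:52:44Z; F0P5a LEAD WORDS #11/#12; MOD-PLAN row L5.5a): the SCHEME ↔ ALGEBRA bridge for the finite base
change.  Everything here is Mathlib plumbing assembled once, in the exact currency the (S-γ2) assembly consumes:

* §1 a FINITE morphism `q : P ⟶ Spec R` has AFFINE source (`isAffine_of_isFinite`), its global-sections map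
  `φ_q := (Scheme.ΓSpecIso R)⁻¹ ≫ q.appTop : R ⟶ Γ(P, ⊤)` is a FINITE ring map (`finite_ΓSpecIso_inv_comp_appTop`), FLAT when `q` is
  flat (`flat_ΓSpecIso_inv_comp_appTop`), and `P ≅ Spec Γ(P, ⊤)` over `Spec R` (`isoSpec_hom_SpecMap_eq`);
* §2 the MODULE reading under `φ_q.toAlgebra`: `Γ(P, ⊤)` is `Module.Finite` / `Module.Flat` over `R`, hence `Module.Free` of finite rank
  when `R` is LOCAL (Mathlib `Module.free_of_flat_of_isLocalRing`, [StacksProject 00NZ]) — no finite-presentation or noetherian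
  hypothesis, so it applies to the valuation ring `closureValuationSubring \overline{K_v}` of the D1 reduction map;
* §3 ring maps `Γ(P, ⊤) ⟶ S` under `R` ARE the `R`-algebra maps (`bijective_ofHom_algHom`), the socket between the `Spec`-side
  bookkeeping (`{t : Spec S ⟶ P // t ≫ q = Spec.map h}`, row L2b) and the algebra-side point counts (`Γ(P, ⊤) →ₐ[R] Ω`, ★
  `Literature.RingTheory.Etale.card_algHom_eq_finrank_of_isReduced_baseChange`, ★ `Literature.RingTheory.Idempotents.*`);
* §4 the case of record: the BASE CHANGE `pullback g s ⟶ Spec R` of a finite (flat) `g : Y ⟶ Z` along a point `s : Spec R ⟶ Z`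
  (Mathlib: `IsFinite`, `Flat` are stable under base change) — `isAffine_pullback`, `finite_appTop_snd`, `flat_appTop_snd`,
  `moduleFree_sections_pullback`.

HC_CM is proved only modulo the 7 printed citations until rung 0 closes; this file is a generic leaf and changes no count.

## References
* [StacksProject] The Stacks Project, Tags 01WG, 01WJ (finite morphisms), 01U2 (flat morphisms, base change), 00NZ (finite flat
  modules over local rings are free), 01I1 (morphisms into affine schemes).
* [GortzWedhorn2020] U. Görtz, T. Wedhorn, *Algebraic Geometry I*, 2nd ed. (2020), Ch. 12 (affine and finite morphisms, stability under
  base change), Ch. 14 (flat morphisms), Ch. 3 (morphisms into affine schemes) — background only; the tagged locators are Stacks tags.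
* [Matsumura1987] H. Matsumura, *Commutative Ring Theory*, Thm. 7.10 (finite flat over local is free).
* [AtiyahMacdonald1969] M. F. Atiyah, I. G. Macdonald, *Introduction to Commutative Algebra* (1969), Ch. 2 p. 30 (algebras and
  algebra homomorphisms: `f ∘ (structure map) = structure map`).
-/

set_option autoImplicit false

noncomputable section

open CategoryTheory CategoryTheory.Limits AlgebraicGeometry

universe u

namespace Literature.AlgebraicGeometry.Morphisms

variable {P Y Z : Scheme.{u}} {R : CommRingCat.{u}}

/-! ### §1 Finite morphisms to an affine scheme: affine source, finite (flat) global-sections map -/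

/-- The source of a finite morphism to `Spec R` is affine (finite ⇒ affine morphism; Mathlib `isAffine_of_isAffineHom`).
[cite: StacksProject, Tag 01WG] -/
theorem isAffine_of_isFinite (q : P ⟶ Spec R) [IsFinite q] : IsAffine P :=
  isAffine_of_isAffineHom q

/-- For a finite `q : P ⟶ Spec R` the map on global sections `q.appTop : Γ(Spec R, ⊤) ⟶ Γ(P, ⊤)` is a finite ring map (the defining
property of `IsFinite` on the affine open `⊤ ⊆ Spec R`). [cite: StacksProject, Tag 01WJ] -/
theorem finite_appTop (q : P ⟶ Spec R) [IsFinite q] : q.appTop.hom.Finite :=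
  q.finite_app ⊤ (isAffineOpen_top (Spec R))

/-- The inverse of Mathlib's `Γ(Spec R, ⊤) ≅ R` is a finite ring map (it is a ring isomorphism). [folklore] -/
private theorem finite_ΓSpecIso_inv (R : CommRingCat.{u}) : (Scheme.ΓSpecIso R).inv.hom.Finite :=
  (Scheme.ΓSpecIso R).symm.commRingCatIsoToRingEquiv.finite

/-- The inverse of Mathlib's `Γ(Spec R, ⊤) ≅ R` is a flat ring map (it is a ring isomorphism). [folklore] -/
private theorem flat_ΓSpecIso_inv (R : CommRingCat.{u}) : (Scheme.ΓSpecIso R).inv.hom.Flat :=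
  RingHom.Flat.of_bijective (Scheme.ΓSpecIso R).symm.commRingCatIsoToRingEquiv.bijective

/-- **The structure map `φ_q := (ΓSpecIso R)⁻¹ ≫ q.appTop : R ⟶ Γ(P, ⊤)` of a finite `q : P ⟶ Spec R` is a FINITE ring map**
(`Γ(P, ⊤)` is a module-finite `R`-algebra). [cite: StacksProject, Tag 01WJ] -/
theorem finite_ΓSpecIso_inv_comp_appTop (q : P ⟶ Spec R) [IsFinite q] :
    ((Scheme.ΓSpecIso R).inv ≫ q.appTop).hom.Finite := by
  rw [CommRingCat.hom_comp]
  exact (finite_appTop q).comp (finite_ΓSpecIso_inv R)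

/-- For a finite FLAT `q : P ⟶ Spec R` the map on global sections is a flat ring map (`Flat` is affine-locally `RingHom.Flat`; both
`P` and `Spec R` are affine). [cite: StacksProject, Tag 01U2] -/
theorem flat_appTop (q : P ⟶ Spec R) [IsFinite q] [Flat q] : q.appTop.hom.Flat := by
  haveI : IsAffine P := isAffine_of_isFinite q
  exact HasRingHomProperty.appTop (P := @Flat) q inferInstance

/-- **The structure map `φ_q : R ⟶ Γ(P, ⊤)` of a finite flat `q : P ⟶ Spec R` is a FLAT ring map.** [cite: StacksProject, Tag 01U2] -/
theorem flat_ΓSpecIso_inv_comp_appTop (q : P ⟶ Spec R) [IsFinite q] [Flat q] :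
    ((Scheme.ΓSpecIso R).inv ≫ q.appTop).hom.Flat := by
  rw [CommRingCat.hom_comp]
  exact (flat_ΓSpecIso_inv R).comp (flat_appTop q)

/-- **`P = Spec Γ(P, ⊤)` over `Spec R`**: for a finite `q : P ⟶ Spec R`, Mathlib's `P.isoSpec : P ≅ Spec Γ(P, ⊤)` lies over `Spec R`
through `Spec φ_q` — `P.isoSpec.hom ≫ Spec.map φ_q = q` (naturality of `toSpecΓ`, and `Spec.map` of `ΓSpecIso` is `toSpecΓ` of `Spec R`).
[cite: StacksProject, Tag 01I1] -/
theorem isoSpec_hom_SpecMap_eq [IsAffine P] (q : P ⟶ Spec R) :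
    P.isoSpec.hom ≫ Spec.map ((Scheme.ΓSpecIso R).inv ≫ q.appTop) = q := by
  rw [Spec.map_comp, Scheme.isoSpec_hom_naturality_assoc, Scheme.isoSpec_Spec_hom, ← Spec.map_comp, Iso.inv_hom_id,
    Spec.map_id, Category.comp_id]

/-- The inverse form: `Spec.map φ_q ≫ 𝟙 = P.isoSpec.inv ≫ q`, i.e. `P.isoSpec.inv ≫ q = Spec.map φ_q` as morphisms
`Spec Γ(P, ⊤) ⟶ Spec R`. [cite: StacksProject, Tag 01I1] -/
theorem isoSpec_inv_comp_eq [IsAffine P] (q : P ⟶ Spec R) :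
    P.isoSpec.inv ≫ q = Spec.map ((Scheme.ΓSpecIso R).inv ≫ q.appTop) := by
  rw [Iso.inv_comp_eq, isoSpec_hom_SpecMap_eq]

/-! ### §2 The module reading: `Γ(P, ⊤)` is a finite (flat, free) `R`-module under `φ_q` -/

/-- `Γ(P, ⊤)` is a FINITE `R`-module through `φ_q`, for `q : P ⟶ Spec R` finite. [cite: StacksProject, Tag 01WJ] -/
theorem moduleFinite_sections (q : P ⟶ Spec R) [IsFinite q] :
    letI := ((Scheme.ΓSpecIso R).inv ≫ q.appTop).hom.toAlgebra
    Module.Finite R Γ(P, ⊤) :=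
  finite_ΓSpecIso_inv_comp_appTop q

/-- `Γ(P, ⊤)` is a FLAT `R`-module through `φ_q`, for `q : P ⟶ Spec R` finite flat. [cite: StacksProject, Tag 01U2] -/
theorem moduleFlat_sections (q : P ⟶ Spec R) [IsFinite q] [Flat q] :
    letI := ((Scheme.ΓSpecIso R).inv ≫ q.appTop).hom.toAlgebra
    Module.Flat R Γ(P, ⊤) :=
  flat_ΓSpecIso_inv_comp_appTop q

/-- **Finite flat over a LOCAL base is free**: for `R` local and `q : P ⟶ Spec R` finite flat, `Γ(P, ⊤)` is a FREE `R`-module of finite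
rank through `φ_q` (Mathlib `Module.free_of_flat_of_isLocalRing`; no noetherian / finite-presentation hypothesis — the case of record is
the valuation ring of `\overline{K_v}`). [cite: StacksProject, Tag 00NZ] [cite: Matsumura1987, Thm. 7.10] -/
theorem moduleFree_sections [IsLocalRing R] (q : P ⟶ Spec R) [IsFinite q] [Flat q] :
    letI := ((Scheme.ΓSpecIso R).inv ≫ q.appTop).hom.toAlgebra
    Module.Free R Γ(P, ⊤) := by
  letI := ((Scheme.ΓSpecIso R).inv ≫ q.appTop).hom.toAlgebra
  haveI : Module.Finite R Γ(P, ⊤) := moduleFinite_sections q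
  haveI : Module.Flat R Γ(P, ⊤) := moduleFlat_sections q
  exact Module.free_of_flat_of_isLocalRing

/-! ### §3 Ring maps under `R` out of `Γ(P, ⊤)` are the `R`-algebra maps -/

section AlgHom

variable {A B : CommRingCat.{u}} (φ : A ⟶ B) (S : Type u) [CommRing S] [Algebra A S]

/-- An `A`-algebra map `B →ₐ[A] S` (for the algebra structure `φ.toAlgebra` on `B`) is a ring map UNDER `A`:
`φ ≫ f = algebraMap A S` in `CommRingCat` (the defining property of an `A`-algebra homomorphism).
[cite: AtiyahMacdonald1969, Ch. 2 p. 30 (A-algebra homomorphisms)] -/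
theorem comp_ofHom_algHom (f : letI := φ.hom.toAlgebra; B →ₐ[A] S) :
    φ ≫ CommRingCat.ofHom (letI := φ.hom.toAlgebra; f.toRingHom) = CommRingCat.ofHom (algebraMap A S) := by
  letI := φ.hom.toAlgebra
  ext a
  change f (algebraMap A B a) = algebraMap A S a
  exact f.commutes a

/-- **Ring maps `B ⟶ S` under `A` ARE the `A`-algebra maps `B →ₐ[A] S`** (algebra structure `φ.toAlgebra` on `B`): the map
`f ↦ ofHom f` is a bijection onto `{ψ : B ⟶ S // φ ≫ ψ = algebraMap}`.  With `B = Γ(P, ⊤)`, `φ = φ_q` this is the socket between the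
`Spec`-side description of points of `P` over `Spec R` and the algebra-side point counts.
[cite: AtiyahMacdonald1969, Ch. 2 p. 30 (A-algebra homomorphisms)] -/
theorem bijective_ofHom_algHom :
    Function.Bijective (fun f : (letI := φ.hom.toAlgebra; B →ₐ[A] S) =>
      (⟨CommRingCat.ofHom (letI := φ.hom.toAlgebra; f.toRingHom), comp_ofHom_algHom φ S f⟩ :
        {ψ : B ⟶ CommRingCat.of S // φ ≫ ψ = CommRingCat.ofHom (algebraMap A S)})) := by
  letI := φ.hom.toAlgebra
  refine ⟨fun f g h => ?_, fun ψ => ?_⟩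
  · apply AlgHom.ext
    intro b
    have h' := congrArg (fun t => t.1.hom b) h
    exact h'
  · refine ⟨{ ψ.1.hom with commutes' := fun a => ?_ }, ?_⟩
    · have h := congrArg (fun t => t.hom a) ψ.2
      change ψ.1.hom (φ.hom a) = algebraMap A S a
      simpa using h
    · apply Subtype.ext
      ext b
      rfl

/-- The cardinality form: `Nat.card (B →ₐ[A] S) = Nat.card {ψ : B ⟶ S // φ ≫ ψ = algebraMap}`.
[cite: AtiyahMacdonald1969, Ch. 2 p. 30 (A-algebra homomorphisms)] -/
theorem card_algHom_eq_card_under :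
    Nat.card (letI := φ.hom.toAlgebra; B →ₐ[A] S) =
      Nat.card {ψ : B ⟶ CommRingCat.of S // φ ≫ ψ = CommRingCat.ofHom (algebraMap A S)} :=
  Nat.card_eq_of_bijective _ (bijective_ofHom_algHom φ S)

end AlgHom

/-! ### §4 The case of record: base change of a finite (flat) morphism along a point of the base -/

/-- **The base change of a finite morphism along `s : Spec R ⟶ Z` is affine**: `pullback g s` is an affine scheme (`pullback.snd g s`
is finite, hence an affine morphism, over the affine `Spec R`). [cite: StacksProject, Tag 01WG] -/
theorem isAffine_pullback (g : Y ⟶ Z) [IsFinite g] (s : Spec R ⟶ Z) : IsAffine (pullback g s) :=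
  isAffine_of_isFinite (pullback.snd g s)

/-- The structure map `R ⟶ Γ(pullback g s, ⊤)` of the base change of a finite `g` is a FINITE ring map.
[cite: StacksProject, Tag 01WJ] -/
theorem finite_appTop_snd (g : Y ⟶ Z) [IsFinite g] (s : Spec R ⟶ Z) :
    ((Scheme.ΓSpecIso R).inv ≫ (pullback.snd g s).appTop).hom.Finite :=
  finite_ΓSpecIso_inv_comp_appTop (pullback.snd g s)

/-- The structure map `R ⟶ Γ(pullback g s, ⊤)` of the base change of a finite FLAT `g` is a FLAT ring map.
[cite: StacksProject, Tag 01U2] -/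
theorem flat_appTop_snd (g : Y ⟶ Z) [IsFinite g] [Flat g] (s : Spec R ⟶ Z) :
    ((Scheme.ΓSpecIso R).inv ≫ (pullback.snd g s).appTop).hom.Flat :=
  flat_ΓSpecIso_inv_comp_appTop (pullback.snd g s)

/-- **`Γ(pullback g s, ⊤)` is a finite FREE `R`-module for `g` finite flat and `R` local** (the fibre algebra `B` of the (S-γ2)
dictionary: finite flat cover, base-changed to the valuation ring of a geometric point). [cite: StacksProject, Tag 00NZ]
[cite: Matsumura1987, Thm. 7.10] -/
theorem moduleFree_sections_pullback [IsLocalRing R] (g : Y ⟶ Z) [IsFinite g] [Flat g] (s : Spec R ⟶ Z) :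
    letI := ((Scheme.ΓSpecIso R).inv ≫ (pullback.snd g s).appTop).hom.toAlgebra
    Module.Free R Γ(pullback g s, ⊤) :=
  moduleFree_sections (pullback.snd g s)

/-- `Γ(pullback g s, ⊤)` is a FINITE `R`-module for `g` finite. [cite: StacksProject, Tag 01WJ] -/
theorem moduleFinite_sections_pullback (g : Y ⟶ Z) [IsFinite g] (s : Spec R ⟶ Z) :
    letI := ((Scheme.ΓSpecIso R).inv ≫ (pullback.snd g s).appTop).hom.toAlgebra
    Module.Finite R Γ(pullback g s, ⊤) :=
  moduleFinite_sections (pullback.snd g s)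

end Literature.AlgebraicGeometry.Morphisms

end
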